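import Summits.SmoothPoincare4.SmoothPoincare4.Theorems.SymplecticOrigamiOrigamiFoldExistenceStubOuterCleanRecognitionGlue
import Summits.SmoothPoincare4.SmoothPoincare4.Theorems.SymplecticOrigamiOrigamiFoldExistenceShadowPleatsOuterCleanDefs

/-!
# Stub `stub_outerCleanRecognition` of line `shadow-pleats` for crux `OrigamiFoldExistence` — II:
# the registered stub reduced to `OuterCleanRecognitionChart`
(item stmt-SmoothPoincare4-7844, route route-SmoothPoincare4-SymplecticOrigami; line lead seat c3, S4'' worker, wave 2)

File I (`…StubOuterCleanRecognitionGlue.lean`) names the ONE geometric ingredient `OuterCleanRecognitionChart` of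
the registered stub S4'' `stub_outerCleanRecognition` (skeleton r5; TRUE on paper by the lead's outer-clean
recognition theorem, `OuterClean-analysis-c3.md` O1–O3, audited in `work/stubs/stub_outerCleanRecognition.md` §A)
and kernel-checks the glue `nonempty_diffeomorph_of_chartComplement` (lifted outer crease is a smooth `S³ ↪ S⁴`;
Schoenflies in ball form; side argument; two-disc cover; Cerf).  This file states the reduction over the line's
outer-clean vocabulary (`IsOuterCleanPleat`, `HasOuterCleanPleatedPosition`, `hasOuterCleanPleatedPosition_one_iff`
of `…ShadowPleatsOuterCleanDefs.lean`): `OuterCleanRecognitionChart` implies the registered statement VERBATIM.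
-/

noncomputable section

-- the prescribed namespace `Summit.<P>.<Sub>.…` duplicates `SmoothPoincare4` (P = Sub)
set_option linter.dupNamespace false

open scoped Manifold ContDiff Topology
open Set Function Metric ContinuousMap

namespace Summit.SmoothPoincare4.SmoothPoincare4.Theorems.OrigamiFoldExistence.ShadowPleats

/-- **The registered stub `stub_outerCleanRecognition`, reduced to `OuterCleanRecognitionChart`**: the
ingredient implies, VERBATIM, OUTER-CLEAN RECOGNITION — given smooth Schoenflies (`EuclideanOrigami.Schoenflies`)
and Cerf's `Γ₄ = 0` (`SymplecticOrigami.CerfGammaFour`), a homotopy `4`-sphere with an outer-clean `1`-pleat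
round-rim shadow position (`HasOuterCleanPleatedPosition M 1`) is diffeomorphic to `S⁴`.  Chain: lifted outer
crease is a smooth `S³ ↪ S⁴` ⟶ Schoenflies ball on the far side of the chimney ⟶ side argument ⟶ two-disc
cover ⟶ twisted sphere ⟶ Cerf (`nonempty_diffeomorph_of_chartComplement`, file I). [folklore] -/
theorem outerCleanRecognition_of_chart (hI : OuterCleanRecognitionChart) :
    Summit.SmoothPoincare4.SmoothPoincare4.Theses.EuclideanOrigami.Schoenflies →
    Summit.SmoothPoincare4.SmoothPoincare4.Theses.SymplecticOrigami.CerfGammaFour →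
    ∀ (M : Type) [TopologicalSpace M] [T2Space M] [SecondCountableTopology M]
      [ChartedSpace (EuclideanSpace ℝ (Fin 4)) M] [IsManifold (𝓡 4) ∞ M],
      M ≃ₕ (Metric.sphere (0 : EuclideanSpace ℝ (Fin 5)) 1) →
      HasOuterCleanPleatedPosition M 1 →
      Nonempty (M ≃ₘ⟮𝓡 4, 𝓡 4⟯ (Metric.sphere (0 : EuclideanSpace ℝ (Fin 5)) 1)) := by
  intro hS hC M _ _ _ _ _ hM hpos
  obtain ⟨ι, δ, e, hP, hclean⟩ := (hasOuterCleanPleatedPosition_one_iff M).1 hpos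
  obtain ⟨Φ, U, hUo, hUc, hXc, hfr, hΦ, hΦi, hΦd, hΦU, hΦc⟩ := hI M hM ι δ e hP hclean
  have he : Manifold.IsSmoothEmbedding (𝓡 4) (𝓡 4) ∞ (e 0) := (hP.2.2.2.2.1 0).1
  exact nonempty_diffeomorph_of_chartComplement hS hC he (c := liftS4 ∘ (proj5 ∘ ι ∘ e 0))
    (isSmoothEmbedding_liftedCrease hP hclean) hUo hUc hXc hfr hΦ hΦi hΦd hΦU hΦc

end Summit.SmoothPoincare4.SmoothPoincare4.Theorems.OrigamiFoldExistence.ShadowPleats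

end
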